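import Summits.AnomalousDissipation.AnomalousDissipation.Theorems.SolenoidalFractalHomogenisationLagrangianStepCellLawVSlowGraphBall
import Mathlib.Analysis.SpecialFunctions.ExpDeriv
import HarnessLib

/-!
# K1L `LagrangianRenormalisationStep(Design)` (K1L_D, stmt-AnomalousDissipation-27980; aside 24912), stub `stub_cellLawV0_IS`
# — the ABSTRACT SLOW-GRAPH LEVER, part 4: EXPONENTIAL CONTRACTION between Riccati graphs in the invariant ball, and UNIQUENESS
# (helper; `--supports stmt-AnomalousDissipation-27980`; word-independent)

Summits-side helper file of route `SolenoidalFractalHomogenisation` (planner ad-ideate-p5's STUB-PLAN for `stub_cellLawV` §1 (V) step V3 «transient of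
`L` from `0` to `L_per` costs `1/(γP)`», crux idea `chang-slow-graph`, `Cruxes/LagrangianRenormalisationStep/SlowGraphSketch.lean` §G), on top of part 1
`…CellLawVSlowGraphBall` (G1 `riccatiInvariantBall`, p661616).  Under G1's hypotheses (`γ`-dissipative fast block, `‖A₁₁‖ ≤ s₀ < γ`, couplings `≤ δ`,
`8δ² ≤ (γ−s₀)²`, `r = 2δ/(γ−s₀)`) two solutions `L, L̃` of `L̇ = A₂₁ + A₂₂L − LA₁₁ − LA₁₂L` starting in the ball `‖·‖ ≤ r` approach each other
exponentially: `‖L t − L̃ t‖ ≤ e^{−κt} ‖L 0 − L̃ 0‖`, `κ = (γ − s₀)(1 − r²) > 0` (`riccati_contraction`); in particular the solution from a given graph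
is UNIQUE (`riccati_unique`).  This is the fading of the transient of Chang's graph (the empty graph `L(0) = 0` of the single-mode datum relaxes to
the periodic graph within `O(1/κ)`), and the contraction that produces the periodic graph as a fixed point of the period map.
PROOF (operator-norm right-Dini estimate, as in part 1).  `D = L − L̃` solves `Ḋ = A₂₂D − DA₁₁ − (DA₁₂L + L̃A₁₂D)`; for `‖ξ‖ = 1`, `u = ‖Dξ‖ ≤ N = ‖D‖`:
`⟪Dξ, Ḋξ⟫ ≤ −(γ − rδ)u² + N(s₀ + rδ)u` (`inner_apply_riccatiDiff_le`), whence for the exponentially weighted defect `D̂ = e^{κt}D`,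
`‖(1 + hκ)D + hḊ‖² ≤ (1 − h²κ²)N² + h²‖Ḋ‖²` on the unit sphere (monotonicity in `u`), i.e. the Taylor point of `‖D̂‖` does not grow to first order
(`norm_add_smul_riccatiDiff_le`); the fencing theorem `image_le_of_liminf_slope_right_le_deriv_boundary` with the constant barrier `‖D̂ 0‖` closes.
No named facts, no new definitions, no sorry.  Kokotović–Bensoussan–Blankenship 1987 §2 (2.29)/Thm 2.3 (Chang 1972) with energy dissipativity in place
of the Hurwitz hypothesis.  Infrastructure for route-1's rung leaf F-D1.A0 (frontier FORMAL rung); NOT a proof of the stub, of the crux, of Onsager's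
conjecture or of anomalous dissipation.  Prover seat `ad-k1l-cellLawV-w1` g3, 2026-08-28.
-/

set_option linter.dupNamespace false

noncomputable section

namespace Summit.AnomalousDissipation.AnomalousDissipation.Theorems.SolenoidalFractalHomogenisation.LagrangianStep

namespace SlowGraph

open Set Filter Topology
open scoped InnerProductSpace

/-! ## §9 The difference of two Riccati fields in the energy norm -/

section Diff

variable {E F : Type*} [NormedAddCommGroup E] [InnerProductSpace ℝ E] [NormedAddCommGroup F] [InnerProductSpace ℝ F]
variable {A₁₁ : E →L[ℝ] E} {A₁₂ : F →L[ℝ] E} {A₂₁ : E →L[ℝ] F} {A₂₂ : F →L[ℝ] F} {γ δ s₀ r : ℝ}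

/-- The difference of the Riccati fields at `L` and `L̃` applied to `ξ`, in terms of `D = L − L̃`:
`(L̇ − L̃̇)ξ = A₂₂(Dξ) − D(A₁₁ξ) − D(A₁₂(Lξ)) − L̃(A₁₂(Dξ))`. [folklore] -/
theorem riccatiDiff_apply (A₁₁ : E →L[ℝ] E) (A₁₂ : F →L[ℝ] E) (A₂₁ : E →L[ℝ] F) (A₂₂ : F →L[ℝ] F) (L L' : E →L[ℝ] F) (ξ : E) :
    ((A₂₁ + A₂₂.comp L - L.comp A₁₁ - (L.comp A₁₂).comp L) - (A₂₁ + A₂₂.comp L' - L'.comp A₁₁ - (L'.comp A₁₂).comp L')) ξ =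
      A₂₂ ((L - L') ξ) - (L - L') (A₁₁ ξ) - (L - L') (A₁₂ (L ξ)) - L' (A₁₂ ((L - L') ξ)) := by
  simp only [FunLike.coe_sub, FunLike.coe_add, Pi.sub_apply, Pi.add_apply, ContinuousLinearMap.comp_apply, map_sub]
  abel

/-- **Energy inequality for the difference of two graphs in the ball**: with `D = L − L̃`, `‖L‖, ‖L̃‖ ≤ r`, `N = ‖D‖`, for every `ξ`:
`⟪Dξ, (L̇ − L̃̇)ξ⟫ ≤ −(γ − rδ)‖Dξ‖² + N(s₀ + rδ)‖ξ‖‖Dξ‖`. [folklore] -/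
theorem inner_apply_riccatiDiff_le (hA₂₂ : ∀ z : F, ⟪A₂₂ z, z⟫_ℝ ≤ -γ * ‖z‖ ^ 2) (h₁₁ : ‖A₁₁‖ ≤ s₀) (h₁₂ : ‖A₁₂‖ ≤ δ)
    {L L' : E →L[ℝ] F} (hL : ‖L‖ ≤ r) (hL' : ‖L'‖ ≤ r) (ξ : E) :
    ⟪(L - L') ξ, ((A₂₁ + A₂₂.comp L - L.comp A₁₁ - (L.comp A₁₂).comp L) - (A₂₁ + A₂₂.comp L' - L'.comp A₁₁ - (L'.comp A₁₂).comp L')) ξ⟫_ℝ ≤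
      -(γ - r * δ) * ‖(L - L') ξ‖ ^ 2 + ‖L - L'‖ * (s₀ + r * δ) * (‖ξ‖ * ‖(L - L') ξ‖) := by
  have hδ : 0 ≤ δ := le_trans (norm_nonneg _) h₁₂
  have hs₀ : 0 ≤ s₀ := le_trans (norm_nonneg _) h₁₁
  have hr : 0 ≤ r := le_trans (norm_nonneg _) hL
  rw [riccatiDiff_apply, inner_sub_right, inner_sub_right, inner_sub_right]
  set D := L - L' with hD
  set v := D ξ with hv
  have t1 : ⟪v, A₂₂ v⟫_ℝ ≤ -γ * ‖v‖ ^ 2 := by rw [real_inner_comm]; exact hA₂₂ v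
  have t2 : -⟪v, D (A₁₁ ξ)⟫_ℝ ≤ ‖D‖ * s₀ * (‖ξ‖ * ‖v‖) := by
    have h : |⟪v, D (A₁₁ ξ)⟫_ℝ| ≤ ‖v‖ * ‖D (A₁₁ ξ)‖ := abs_real_inner_le_norm _ _
    have h' : ‖D (A₁₁ ξ)‖ ≤ ‖D‖ * (s₀ * ‖ξ‖) :=
      (D.le_opNorm _).trans (mul_le_mul_of_nonneg_left ((A₁₁.le_opNorm ξ).trans (mul_le_mul_of_nonneg_right h₁₁ (norm_nonneg _))) (norm_nonneg _))
    have h'' : ‖v‖ * ‖D (A₁₁ ξ)‖ ≤ ‖D‖ * s₀ * (‖ξ‖ * ‖v‖) := by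
      calc ‖v‖ * ‖D (A₁₁ ξ)‖ ≤ ‖v‖ * (‖D‖ * (s₀ * ‖ξ‖)) := mul_le_mul_of_nonneg_left h' (norm_nonneg _)
        _ = ‖D‖ * s₀ * (‖ξ‖ * ‖v‖) := by ring
    have := (abs_le.mp (h.trans h'')).1
    linarith
  have t3 : -⟪v, D (A₁₂ (L ξ))⟫_ℝ ≤ ‖D‖ * (r * δ) * (‖ξ‖ * ‖v‖) := by
    have h : |⟪v, D (A₁₂ (L ξ))⟫_ℝ| ≤ ‖v‖ * ‖D (A₁₂ (L ξ))‖ := abs_real_inner_le_norm _ _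
    have h' : ‖D (A₁₂ (L ξ))‖ ≤ ‖D‖ * (δ * (r * ‖ξ‖)) := by
      refine (D.le_opNorm _).trans (mul_le_mul_of_nonneg_left ?_ (norm_nonneg _))
      calc ‖A₁₂ (L ξ)‖ ≤ ‖A₁₂‖ * ‖L ξ‖ := A₁₂.le_opNorm _
        _ ≤ δ * (r * ‖ξ‖) := mul_le_mul h₁₂ ((L.le_opNorm ξ).trans (mul_le_mul_of_nonneg_right hL (norm_nonneg _))) (norm_nonneg _) hδ
    have h'' : ‖v‖ * ‖D (A₁₂ (L ξ))‖ ≤ ‖D‖ * (r * δ) * (‖ξ‖ * ‖v‖) := by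
      calc ‖v‖ * ‖D (A₁₂ (L ξ))‖ ≤ ‖v‖ * (‖D‖ * (δ * (r * ‖ξ‖))) := mul_le_mul_of_nonneg_left h' (norm_nonneg _)
        _ = ‖D‖ * (r * δ) * (‖ξ‖ * ‖v‖) := by ring
    have := (abs_le.mp (h.trans h'')).1
    linarith
  have t4 : -⟪v, L' (A₁₂ v)⟫_ℝ ≤ r * δ * ‖v‖ ^ 2 := by
    have h : |⟪v, L' (A₁₂ v)⟫_ℝ| ≤ ‖v‖ * ‖L' (A₁₂ v)‖ := abs_real_inner_le_norm _ _
    have h' : ‖L' (A₁₂ v)‖ ≤ r * (δ * ‖v‖) :=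
      (L'.le_opNorm _).trans (mul_le_mul hL' ((A₁₂.le_opNorm v).trans (mul_le_mul_of_nonneg_right h₁₂ (norm_nonneg _))) (norm_nonneg _) hr)
    have h'' : ‖v‖ * ‖L' (A₁₂ v)‖ ≤ r * δ * ‖v‖ ^ 2 := by
      calc ‖v‖ * ‖L' (A₁₂ v)‖ ≤ ‖v‖ * (r * (δ * ‖v‖)) := mul_le_mul_of_nonneg_left h' (norm_nonneg _)
        _ = r * δ * ‖v‖ ^ 2 := by ring
    have := (abs_le.mp (h.trans h'')).1
    linarith
  nlinarith [t1, t2, t3, t4]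

/-- **The weighted Taylor-point estimate**: with `D = L − L̃` in the ball, `κ = γ − s₀ − 2rδ ≥ 0` and `Ḋ` the difference of the Riccati fields,
for every `r' > 0` and all small `h > 0`: `‖(1 + hκ)•D + h•Ḋ‖ ≤ ‖D‖ + h r'` — to first order the exponential weight `e^{κt}` exactly compensates
the contraction. [folklore] -/
theorem norm_add_smul_riccatiDiff_le (hA₂₂ : ∀ z : F, ⟪A₂₂ z, z⟫_ℝ ≤ -γ * ‖z‖ ^ 2) (h₁₁ : ‖A₁₁‖ ≤ s₀) (h₁₂ : ‖A₁₂‖ ≤ δ)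
    {L L' : E →L[ℝ] F} (hL : ‖L‖ ≤ r) (hL' : ‖L'‖ ≤ r) {κ : ℝ} (hκ0 : 0 ≤ κ) (hκ : κ ≤ γ - s₀ - 2 * r * δ)
    {r' : ℝ} (hr' : 0 < r') :
    ∃ η > 0, ∀ h ∈ Ioo 0 η, ‖(1 + h * κ) • (L - L') +
      h • ((A₂₁ + A₂₂.comp L - L.comp A₁₁ - (L.comp A₁₂).comp L) - (A₂₁ + A₂₂.comp L' - L'.comp A₁₁ - (L'.comp A₁₂).comp L'))‖ ≤
        ‖L - L'‖ + h * r' := by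
  have hδ : 0 ≤ δ := le_trans (norm_nonneg _) h₁₂
  have hs₀ : 0 ≤ s₀ := le_trans (norm_nonneg _) h₁₁
  have hr : 0 ≤ r := le_trans (norm_nonneg _) hL
  set D := L - L' with hD
  set D' := (A₂₁ + A₂₂.comp L - L.comp A₁₁ - (L.comp A₁₂).comp L) - (A₂₁ + A₂₂.comp L' - L'.comp A₁₁ - (L'.comp A₁₂).comp L') with hD'
  set N := ‖D‖ with hN
  have hN0 : 0 ≤ N := norm_nonneg _
  rcases hN0.eq_or_lt with hN00 | hNpos
  · -- `D = 0`: then `Ḋ = 0` as well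
    have hD0 : D = 0 := by rw [← norm_eq_zero]; exact hN00.symm
    have hLL' : L = L' := sub_eq_zero.mp (by rw [← hD]; exact hD0)
    have hD'0 : D' = 0 := by
      ext ξ
      rw [hD', riccatiDiff_apply, ← hD, hD0, hLL']
      simp
    refine ⟨1, one_pos, fun h hh => ?_⟩
    rw [hD0, hD'0, smul_zero, smul_zero, add_zero, norm_zero, ← hN00, zero_add]
    exact mul_nonneg hh.1.le hr'.le
  · set a := N * (s₀ + r * δ) with ha
    set b := γ - r * δ with hb
    set C := ‖D'‖ ^ 2 with hC
    have ha0 : 0 ≤ a := by rw [ha]; positivity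
    have hC0 : 0 ≤ C := by rw [hC]; positivity
    -- window for `h`: (i) `(1 + hκ) ≥ 2hb`, (ii) `h C ≤ 2 N r'`, (iii) `h r' ≤ N` is not needed but `N + h r' ≥ 0` is automatic
    set η := min (1 / (2 * |b| + 1)) (2 * N * r' / (C + 1)) with hη
    have hη1 : 0 < 1 / (2 * |b| + 1) := by positivity
    have hη2 : 0 < 2 * N * r' / (C + 1) := by positivity
    have hηpos : 0 < η := lt_min hη1 hη2
    refine ⟨η, hηpos, fun h hh => ?_⟩
    have hh0 : 0 < h := hh.1
    have hhle1 : h < 1 / (2 * |b| + 1) := lt_of_lt_of_le hh.2 (min_le_left _ _)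
    have hhle2 : h < 2 * N * r' / (C + 1) := lt_of_lt_of_le hh.2 (min_le_right _ _)
    have hi : 0 ≤ (1 + h * κ) - 2 * h * b := by
      have h1 : h * (2 * |b| + 1) < 1 := by rwa [lt_div_iff₀ (by positivity)] at hhle1
      have h2 : 2 * h * b ≤ 2 * h * |b| := by nlinarith [le_abs_self b]
      nlinarith [abs_nonneg b, mul_nonneg hh0.le hκ0]
    have hii : h * C ≤ 2 * N * r' := by
      have h1 : h * (C + 1) < 2 * N * r' := by rwa [lt_div_iff₀ (by positivity)] at hhle2
      nlinarith
    have hpos : 0 ≤ N + h * r' := by positivity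
    have h1κ : 0 ≤ 1 + h * κ := by positivity
    refine ContinuousLinearMap.opNorm_le_of_unit_norm hpos fun ξ hξ => ?_
    have hu : ‖D ξ‖ ≤ N := by simpa [hξ] using D.le_opNorm ξ
    have hu0 : 0 ≤ ‖D ξ‖ := norm_nonneg _
    have hinner : ⟪D ξ, D' ξ⟫_ℝ ≤ a * ‖D ξ‖ - b * ‖D ξ‖ ^ 2 := by
      have := inner_apply_riccatiDiff_le (A₂₁ := A₂₁) hA₂₂ h₁₁ h₁₂ hL hL' ξ
      rw [← hD, ← hD', hξ, one_mul] at this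
      rw [ha, hb]
      linarith
    have hD'ξ : ‖D' ξ‖ ^ 2 ≤ C := by
      rw [hC]
      have : ‖D' ξ‖ ≤ ‖D'‖ := by simpa [hξ] using D'.le_opNorm ξ
      exact pow_le_pow_left₀ (norm_nonneg _) this 2
    have hsq : ‖((1 + h * κ) • D + h • D') ξ‖ ^ 2 ≤ (N + h * r') ^ 2 := by
      have e1 : ((1 + h * κ) • D + h • D') ξ = (1 + h * κ) • D ξ + h • D' ξ := by simp
      rw [e1, norm_add_sq_real, real_inner_smul_left, real_inner_smul_right, norm_smul, norm_smul, Real.norm_eq_abs, Real.norm_eq_abs,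
        abs_of_nonneg h1κ, abs_of_pos hh0]
      -- `(1+hκ)²u² + 2(1+hκ)h⟪Dξ,D'ξ⟫ + h²‖D'ξ‖² ≤ [(1+hκ)² − 2h(1+hκ)b]u² + 2h(1+hκ)a u + h²C ≤ (same at u = N) ≤ N² + h²C ≤ (N + hr')²`
      have s1 : ((1 + h * κ) * ‖D ξ‖) ^ 2 + 2 * ((1 + h * κ) * (h * ⟪D ξ, D' ξ⟫_ℝ)) + (h * ‖D' ξ‖) ^ 2 ≤
          ((1 + h * κ) ^ 2 - 2 * h * (1 + h * κ) * b) * ‖D ξ‖ ^ 2 + 2 * h * (1 + h * κ) * a * ‖D ξ‖ + h ^ 2 * C := by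
        have p4 : (1 + h * κ) * (h * ⟪D ξ, D' ξ⟫_ℝ) ≤ (1 + h * κ) * (h * (a * ‖D ξ‖ - b * ‖D ξ‖ ^ 2)) :=
          mul_le_mul_of_nonneg_left (mul_le_mul_of_nonneg_left hinner hh0.le) h1κ
        have p5 : (h * ‖D' ξ‖) ^ 2 ≤ h ^ 2 * C := by
          rw [mul_pow]; exact mul_le_mul_of_nonneg_left hD'ξ (sq_nonneg _)
        have e : ((1 + h * κ) ^ 2 - 2 * h * (1 + h * κ) * b) * ‖D ξ‖ ^ 2 + 2 * h * (1 + h * κ) * a * ‖D ξ‖ + h ^ 2 * C =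
            ((1 + h * κ) * ‖D ξ‖) ^ 2 + 2 * ((1 + h * κ) * (h * (a * ‖D ξ‖ - b * ‖D ξ‖ ^ 2))) + h ^ 2 * C := by ring
        rw [e]; linarith
      have s2 : ((1 + h * κ) ^ 2 - 2 * h * (1 + h * κ) * b) * ‖D ξ‖ ^ 2 + 2 * h * (1 + h * κ) * a * ‖D ξ‖ ≤
          ((1 + h * κ) ^ 2 - 2 * h * (1 + h * κ) * b) * N ^ 2 + 2 * h * (1 + h * κ) * a * N := by
        have p1 : ‖D ξ‖ ^ 2 ≤ N ^ 2 := pow_le_pow_left₀ hu0 hu 2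
        have pc : 0 ≤ (1 + h * κ) ^ 2 - 2 * h * (1 + h * κ) * b := by
          have : (1 + h * κ) ^ 2 - 2 * h * (1 + h * κ) * b = (1 + h * κ) * ((1 + h * κ) - 2 * h * b) := by ring
          rw [this]; exact mul_nonneg h1κ hi
        have p2 : 0 ≤ 2 * h * (1 + h * κ) * a := by positivity
        exact add_le_add (mul_le_mul_of_nonneg_left p1 pc) (mul_le_mul_of_nonneg_left hu p2)
      -- at `u = N`: `= (1+hκ)N²[(1+hκ) − 2hb + 2h(s₀+rδ)] = (1+hκ)N²[(1+hκ) − 2h(γ − s₀ − 2rδ)] ≤ (1+hκ)(1−hκ)N² ≤ N²`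
      have s3 : ((1 + h * κ) ^ 2 - 2 * h * (1 + h * κ) * b) * N ^ 2 + 2 * h * (1 + h * κ) * a * N ≤ N ^ 2 := by
        have e : ((1 + h * κ) ^ 2 - 2 * h * (1 + h * κ) * b) * N ^ 2 + 2 * h * (1 + h * κ) * a * N =
            (1 + h * κ) * N ^ 2 * ((1 + h * κ) - 2 * h * (γ - s₀ - 2 * r * δ)) := by
          simp only [ha, hb]; ring
        rw [e]
        have p6 : (1 + h * κ) - 2 * h * (γ - s₀ - 2 * r * δ) ≤ 1 - h * κ := by
          have := mul_le_mul_of_nonneg_left hκ hh0.le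
          linarith
        have p7 : (1 + h * κ) * N ^ 2 * ((1 + h * κ) - 2 * h * (γ - s₀ - 2 * r * δ)) ≤ (1 + h * κ) * N ^ 2 * (1 - h * κ) :=
          mul_le_mul_of_nonneg_left p6 (by positivity)
        have p8 : (1 + h * κ) * N ^ 2 * (1 - h * κ) ≤ N ^ 2 := by
          have h9 : 0 ≤ (h * κ) ^ 2 * N ^ 2 := by positivity
          have e9 : (1 + h * κ) * N ^ 2 * (1 - h * κ) = N ^ 2 - (h * κ) ^ 2 * N ^ 2 := by ring
          rw [e9]; linarith
        exact p7.trans p8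
      have s4 : N ^ 2 + h ^ 2 * C ≤ (N + h * r') ^ 2 := by
        have e : (N + h * r') ^ 2 = N ^ 2 + h * (2 * N * r') + h ^ 2 * r' ^ 2 := by ring
        rw [e]
        have q : h * (h * C) ≤ h * (2 * N * r') := mul_le_mul_of_nonneg_left hii hh0.le
        have q' : h ^ 2 * C = h * (h * C) := by ring
        have q'' : 0 ≤ h ^ 2 * r' ^ 2 := by positivity
        linarith
      linarith
    exact (pow_le_pow_iff_left₀ (norm_nonneg _) hpos two_ne_zero).mp hsq

end Diff

/-! ## §10 G4 — exponential contraction of graphs in the ball; uniqueness -/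

section Contraction

/-- **G4 — EXPONENTIAL CONTRACTION OF RICCATI GRAPHS IN THE INVARIANT BALL.**  Under G1's hypotheses two solutions `L, L̃` of Chang's Riccati equation
`L̇ = A₂₁ + A₂₂L − LA₁₁ − LA₁₂L` on `[0, T)` starting in the ball `‖·‖ ≤ r = 2δ/(γ−s₀)` satisfy
`‖L t − L̃ t‖ ≤ e^{−κt}‖L 0 − L̃ 0‖`, `κ = (γ − s₀)(1 − r²)` (`= γ − s₀ − 2rδ > 0`): the transient of the graph fades at the rate `κ`, and the period
map of a periodic system is a strict contraction of the ball. [cite: KokotovicBensoussanBlankenship1987, §2 eq. (2.29), Thm 2.3] -/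
theorem riccati_contraction : ∀ (E F : Type) [NormedAddCommGroup E] [InnerProductSpace ℝ E] [FiniteDimensional ℝ E]
    [NormedAddCommGroup F] [InnerProductSpace ℝ F] [FiniteDimensional ℝ F]
    (A₁₁ : ℝ → E →L[ℝ] E) (A₁₂ : ℝ → F →L[ℝ] E) (A₂₁ : ℝ → E →L[ℝ] F) (A₂₂ : ℝ → F →L[ℝ] F)
    (L L' : ℝ → E →L[ℝ] F) (γ δ s₀ T : ℝ),
    0 < γ → 0 ≤ δ → 0 ≤ s₀ → s₀ < γ → 8 * δ ^ 2 ≤ (γ - s₀) ^ 2 → 0 ≤ T →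
    (∀ t ∈ Icc 0 T, ∀ z : F, ⟪A₂₂ t z, z⟫_ℝ ≤ -γ * ‖z‖ ^ 2) →
    (∀ t ∈ Icc 0 T, ‖A₁₁ t‖ ≤ s₀) → (∀ t ∈ Icc 0 T, ‖A₁₂ t‖ ≤ δ) → (∀ t ∈ Icc 0 T, ‖A₂₁ t‖ ≤ δ) →
    (∀ t ∈ Ico 0 T, HasDerivAt L (A₂₁ t + (A₂₂ t).comp (L t) - (L t).comp (A₁₁ t) - ((L t).comp (A₁₂ t)).comp (L t)) t) →
    (∀ t ∈ Ico 0 T, HasDerivAt L' (A₂₁ t + (A₂₂ t).comp (L' t) - (L' t).comp (A₁₁ t) - ((L' t).comp (A₁₂ t)).comp (L' t)) t) →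
    ContinuousOn L (Icc 0 T) → ContinuousOn L' (Icc 0 T) →
    ‖L 0‖ ≤ 2 * δ / (γ - s₀) → ‖L' 0‖ ≤ 2 * δ / (γ - s₀) →
    ∀ t ∈ Icc 0 T, ‖L t - L' t‖ ≤ Real.exp (-((γ - s₀) * (1 - (2 * δ / (γ - s₀)) ^ 2)) * t) * ‖L 0 - L' 0‖ := by
  intro E F _ _ _ _ _ _ A₁₁ A₁₂ A₂₁ A₂₂ L L' γ δ s₀ T hγ hδ hs₀ hsγ h8 hT hA₂₂ h₁₁ h₁₂ h₂₁ hL hL' hLc hL'c h0 h0' t ht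
  have hball := riccatiInvariantBall E F A₁₁ A₁₂ A₂₁ A₂₂ L γ δ s₀ T hγ hδ hs₀ hsγ h8 hT hA₂₂ h₁₁ h₁₂ h₂₁ hL hLc h0
  have hball' := riccatiInvariantBall E F A₁₁ A₁₂ A₂₁ A₂₂ L' γ δ s₀ T hγ hδ hs₀ hsγ h8 hT hA₂₂ h₁₁ h₁₂ h₂₁ hL' hL'c h0'
  have hgs : 0 < γ - s₀ := by linarith
  set r := 2 * δ / (γ - s₀) with hr
  have hr0 : 0 ≤ r := by positivity
  have hr1 : r ^ 2 ≤ 1 / 2 := by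
    rw [hr, div_pow, div_le_div_iff₀ (by positivity) (by norm_num)]
    nlinarith
  set κ := (γ - s₀) * (1 - r ^ 2) with hκ
  have hκ0 : 0 ≤ κ := by rw [hκ]; exact mul_nonneg hgs.le (by linarith)
  have hκle : κ ≤ γ - s₀ - 2 * r * δ := by
    have e : κ = γ - s₀ - 2 * r * δ := by rw [hκ, hr]; field_simp
    exact e.le
  -- the exponentially weighted defect `D̂ t = e^{κt} (L t − L' t)`
  set Dh : ℝ → E →L[ℝ] F := fun s => Real.exp (κ * s) • (L s - L' s) with hDh
  have hexp : ∀ x : ℝ, HasDerivAt (fun s => Real.exp (κ * s)) (Real.exp (κ * x) * κ) x := fun x => by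
    have h := ((hasDerivAt_id x).const_mul κ).exp
    simpa using h
  have hDhd : ∀ x ∈ Ico 0 T, HasDerivAt Dh (Real.exp (κ * x) •
      ((A₂₁ x + (A₂₂ x).comp (L x) - (L x).comp (A₁₁ x) - ((L x).comp (A₁₂ x)).comp (L x)) -
        (A₂₁ x + (A₂₂ x).comp (L' x) - (L' x).comp (A₁₁ x) - ((L' x).comp (A₁₂ x)).comp (L' x))) +
      (Real.exp (κ * x) * κ) • (L x - L' x)) x := fun x hx => (hexp x).smul ((hL x hx).sub (hL' x hx))
  have hDhc : ContinuousOn Dh (Icc 0 T) :=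
    ((Real.continuous_exp.comp (continuous_const.mul continuous_id)).continuousOn).smul (hLc.sub hL'c)
  have hcontn : ContinuousOn (fun s => ‖Dh s‖) (Icc 0 T) := continuous_norm.comp_continuousOn hDhc
  -- the Dini derivative of `‖D̂‖` is `≤ 0`
  have hDini : ∀ x ∈ Ico 0 T, ∀ ρ : ℝ, (0:ℝ) < ρ → ∃ᶠ z in 𝓝[>] x, slope (fun s => ‖Dh s‖) x z < ρ := by
    intro x hx ρ hρ
    have hxI := Ico_subset_Icc_self hx
    have hex0 : 0 < Real.exp (κ * x) := Real.exp_pos _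
    have hr'' : 0 < ρ / 2 / Real.exp (κ * x) := by positivity
    obtain ⟨η, hη, hTaylor⟩ := norm_add_smul_riccatiDiff_le (A₂₁ := A₂₁ x) (hA₂₂ x hxI) (h₁₁ x hxI) (h₁₂ x hxI)
      (hball x hxI) (hball' x hxI) hκ0 hκle hr''
    refine frequently_slope_norm_lt_of_hasDerivAt (hDhd x hx) ⟨η, hη, fun h hh => ?_⟩ (half_lt_self hρ)
    have e : Dh x + h • (Real.exp (κ * x) •
        ((A₂₁ x + (A₂₂ x).comp (L x) - (L x).comp (A₁₁ x) - ((L x).comp (A₁₂ x)).comp (L x)) -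
          (A₂₁ x + (A₂₂ x).comp (L' x) - (L' x).comp (A₁₁ x) - ((L' x).comp (A₁₂ x)).comp (L' x))) +
        (Real.exp (κ * x) * κ) • (L x - L' x)) =
        Real.exp (κ * x) • ((1 + h * κ) • (L x - L' x) +
          h • ((A₂₁ x + (A₂₂ x).comp (L x) - (L x).comp (A₁₁ x) - ((L x).comp (A₁₂ x)).comp (L x)) -
            (A₂₁ x + (A₂₂ x).comp (L' x) - (L' x).comp (A₁₁ x) - ((L' x).comp (A₁₂ x)).comp (L' x)))) := by
      simp only [hDh]
      module
    rw [e, norm_smul, Real.norm_eq_abs, abs_of_pos hex0]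
    have hDhx : ‖Dh x‖ = Real.exp (κ * x) * ‖L x - L' x‖ := by
      simp only [hDh]; rw [norm_smul, Real.norm_eq_abs, abs_of_pos hex0]
    rw [hDhx]
    calc Real.exp (κ * x) * ‖(1 + h * κ) • (L x - L' x) +
          h • ((A₂₁ x + (A₂₂ x).comp (L x) - (L x).comp (A₁₁ x) - ((L x).comp (A₁₂ x)).comp (L x)) -
            (A₂₁ x + (A₂₂ x).comp (L' x) - (L' x).comp (A₁₁ x) - ((L' x).comp (A₁₂ x)).comp (L' x)))‖
        ≤ Real.exp (κ * x) * (‖L x - L' x‖ + h * (ρ / 2 / Real.exp (κ * x))) := mul_le_mul_of_nonneg_left (hTaylor h hh) hex0.le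
      _ = Real.exp (κ * x) * ‖L x - L' x‖ + h * (ρ / 2) := by field_simp
  have key := image_le_of_liminf_slope_right_le_deriv_boundary (f := fun s => ‖Dh s‖) hcontn (B := fun _ => ‖Dh 0‖) (B' := fun _ => (0:ℝ))
    le_rfl continuousOn_const (fun x _ => (hasDerivAt_const x ‖Dh 0‖).hasDerivWithinAt) (fun x hx ρ hρ => hDini x hx ρ hρ)
  have h1 : ‖Dh t‖ ≤ ‖Dh 0‖ := key ht
  have hDh0 : ‖Dh 0‖ = ‖L 0 - L' 0‖ := by simp [hDh]
  have hDht : ‖Dh t‖ = Real.exp (κ * t) * ‖L t - L' t‖ := by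
    simp only [hDh]; rw [norm_smul, Real.norm_eq_abs, abs_of_pos (Real.exp_pos _)]
  rw [hDh0, hDht] at h1
  have hex : Real.exp (-((γ - s₀) * (1 - r ^ 2)) * t) * Real.exp (κ * t) = 1 := by
    rw [← Real.exp_add, hκ]; ring_nf; exact Real.exp_zero
  calc ‖L t - L' t‖ = Real.exp (-((γ - s₀) * (1 - r ^ 2)) * t) * (Real.exp (κ * t) * ‖L t - L' t‖) := by
        rw [← mul_assoc, hex, one_mul]
    _ ≤ Real.exp (-((γ - s₀) * (1 - r ^ 2)) * t) * ‖L 0 - L' 0‖ := mul_le_mul_of_nonneg_left h1 (Real.exp_pos _).le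

/-- **UNIQUENESS of the Riccati graph from a given initial graph in the ball** (corollary of `riccati_contraction`). [folklore] -/
theorem riccati_unique {E F : Type} [NormedAddCommGroup E] [InnerProductSpace ℝ E] [FiniteDimensional ℝ E]
    [NormedAddCommGroup F] [InnerProductSpace ℝ F] [FiniteDimensional ℝ F]
    {A₁₁ : ℝ → E →L[ℝ] E} {A₁₂ : ℝ → F →L[ℝ] E} {A₂₁ : ℝ → E →L[ℝ] F} {A₂₂ : ℝ → F →L[ℝ] F}
    {L L' : ℝ → E →L[ℝ] F} {γ δ s₀ T : ℝ}
    (hγ : 0 < γ) (hδ : 0 ≤ δ) (hs₀ : 0 ≤ s₀) (hsγ : s₀ < γ) (h8 : 8 * δ ^ 2 ≤ (γ - s₀) ^ 2) (hT : 0 ≤ T)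
    (hA₂₂ : ∀ t ∈ Icc 0 T, ∀ z : F, ⟪A₂₂ t z, z⟫_ℝ ≤ -γ * ‖z‖ ^ 2)
    (h₁₁ : ∀ t ∈ Icc 0 T, ‖A₁₁ t‖ ≤ s₀) (h₁₂ : ∀ t ∈ Icc 0 T, ‖A₁₂ t‖ ≤ δ) (h₂₁ : ∀ t ∈ Icc 0 T, ‖A₂₁ t‖ ≤ δ)
    (hL : ∀ t ∈ Ico 0 T, HasDerivAt L (A₂₁ t + (A₂₂ t).comp (L t) - (L t).comp (A₁₁ t) - ((L t).comp (A₁₂ t)).comp (L t)) t)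
    (hL' : ∀ t ∈ Ico 0 T, HasDerivAt L' (A₂₁ t + (A₂₂ t).comp (L' t) - (L' t).comp (A₁₁ t) - ((L' t).comp (A₁₂ t)).comp (L' t)) t)
    (hLc : ContinuousOn L (Icc 0 T)) (hL'c : ContinuousOn L' (Icc 0 T))
    (h0 : ‖L 0‖ ≤ 2 * δ / (γ - s₀)) (h00 : L 0 = L' 0) : ∀ t ∈ Icc 0 T, L t = L' t := by
  intro t ht
  have h0' : ‖L' 0‖ ≤ 2 * δ / (γ - s₀) := by rw [← h00]; exact h0
  have h := riccati_contraction E F A₁₁ A₁₂ A₂₁ A₂₂ L L' γ δ s₀ T hγ hδ hs₀ hsγ h8 hT hA₂₂ h₁₁ h₁₂ h₂₁ hL hL' hLc hL'c h0 h0' t ht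
  rw [h00, sub_self, norm_zero, mul_zero] at h
  exact sub_eq_zero.mp (norm_le_zero_iff.mp h)

end Contraction

end SlowGraph

end Summit.AnomalousDissipation.AnomalousDissipation.Theorems.SolenoidalFractalHomogenisation.LagrangianStep

end
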